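import Literature.NumberTheory.EllipticCurves.TwoDescentQuadraticTwistLocalConditions
import Literature.NumberTheory.EllipticCurves.BSDRankZeroDensityProofs
import Literature.NumberTheory.EllipticCurves.MordellWeilModNCard
import Literature.NumberTheory.EllipticCurves.TwoTorsionCardProofs
import Literature.NumberTheory.QuadraticForms.HilbertSymbolRatOdd
import HarnessLib

/-!
# Complete `2`-descent, III: the `2`-Selmer group of a rank-zero curve with full rational `2`-torsion
# and `Ш[2] = 0`, and the bookkeeping of components (bits, integral representatives, good places)

For an elliptic curve `E/ℚ` with rational `2`-torsion `e₁, e₂, e₃` (`SplitTwoTorsion`), Mordell–Weil rank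
`0` and `Ш(E/ℚ)[2] = 0`, the exact descent count `#Sel⁽²⁾ = 2^{rk} · #E(ℚ)[2] · #Ш[2]`
(Silverman, *AEC*, Thm. X.4.2; tree `natCard_selmerGroup_eq`) gives `#Sel⁽²⁾(E/ℚ) = 4`
(`natCard_selmerGroup_two_eq_four`, with `#E(ℚ)[2] = 4`, `natCard_torsionBy_two_eq_four`): the Selmer group
IS the image of the rational `2`-torsion. This file draws the two consequences used by the `2`-descent on the
genus twists of such a curve (cell `bsd-f1-sign2`, LINE 49 stub D0≤2):

* §1 **Bits of components are well defined.** The residue bit `qr_p`, the parity bit `v_p mod 2` and the sign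
  of a representative `a ∈ ℚˣ` of a component `[a] ∈ ℚˣ/ℚˣ²` of a class only depend on the class
  (`qrBit_eq_of_mk_eq`, `parityBit_eq_of_mk_eq`, `signBit_eq_of_mk_eq`), and the class `c(a, b)` only depends
  on `[a], [b]` (`twoDescentClass_eq_of_mk_eq`).
* §2 **Integral unit representatives and the good places in rational currency.** A rational of even `ℓ`-adic
  valuation is an `ℓ`-unit integer times a square (`exists_intCast_eq_mul_sq_of_even_padicValRat`); hence at a
  finite place `v ∤ 2` of good reduction the class `c(a, b)` of a pair with EVEN valuations at `v` satisfies the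
  local Selmer condition (`twoDescentClass_mem_selmerLocalKer_of_even`; Silverman X.1.4: `K(S,2)²` contains the
  local image at `v ∉ S` — the tree's `twoDescentClass_mem_selmerLocalKer_of_not_mem` for `𝓞 ℚ`-units).
* §3 **The count**: `#E(ℚ)[2] = 4` and, for rank `0` and `Ш[2] = 0`, `#Sel⁽²⁾(E/ℚ) = 4`.
* §4 **The sign kernel** (`e₁ < e₂`): at most TWO Selmer classes have a positive `T₂`-component
  (`natCard_selmer_signBit_eq_zero_le_two`): `κ(T₁) = ((e₁-e₂)(e₁-e₃), e₁-e₂)` is Selmer with negative second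
  component, and `c ↦ c + κ(T₁)` exchanges the two halves.
* §5 **The residue kernel at an inert prime**: if `q ≡ 3 (mod 4)` is a prime at which
  `δ₁ = (e₁-e₂)(e₁-e₃)` and `δ₂ = (e₂-e₁)(e₂-e₃)` are (units and) NON-residues, the only Selmer class both of
  whose components are residues at `q` is `0` (`eq_zero_of_mem_selmerGroup_of_qrBit_eq_zero`): the four classes
  `0, κ(T₁), κ(T₂), κ(T₁)+κ(T₂)` have residue bits `(0,0), (1,t+1), (t,1), (t+1,t)` (`t = qr_q(e₂-e₁)`), pairwise
  distinct, so they exhaust `Sel⁽²⁾` and only `0` has bits `(0,0)`.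

Theorems only; no named fact. Cell `bsd-f1-sign2` (LEAD gk2-p1), toward LINE 49 stub D0≤2 (crux R″
`RankOneTwoTorsionResidualAtTwo`).

## References

* [SilvermanAEC2009] J. H. Silverman, *The Arithmetic of Elliptic Curves*, 2nd ed., GTM 106, Springer 2009,
  Prop. X.1.4, Thm. X.4.2, Prop. X.4.9.
* [Kramer1981] K. Kramer, *Arithmetic of elliptic curves upon quadratic extension*, Trans. AMS 264 (1981)
  121–135, §1 (the `2`-descent with full `2`-torsion).
-/

noncomputable section

open scoped Classical

universe u

namespace WeierstrassCurve

open Literature.NumberTheory.GaloisRepresentations Literature.NumberTheory.EllipticCurves Field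
open WeierstrassCurve.Affine WeierstrassCurve.Affine.Point
open Literature.NumberTheory.EllipticCurves.TwoDescentLocal
open Literature.NumberTheory.EllipticCurves.KramerTwoDescent
open IsDedekindDomain NumberField Rat.HeightOneSpectrum

/-! ## §1 Bits of components are well defined -/

section Bits

/-- The class of a unit `a ∈ Fˣ` in `Fˣ/Fˣ²` is `sqClass a`. [cite: SilvermanAEC2009, X.§1 (Example X.1.5)] -/
theorem _root_.WeierstrassCurve.Affine.mk_eq_sqClass_coe {F : Type*} [Field F] (a : Fˣ) :
    (QuotientGroup.mk a : SqUnits F) = sqClass (a : F) := by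
  rw [sqClass_of_ne_zero a.ne_zero]
  congr 1
  exact Units.ext (by rw [Units.val_mk0])

/-- Equal square classes differ by a square: `[a] = [a']` gives `a' = a s²`, `s ≠ 0`. [cite: SilvermanAEC2009, X.§1 (Example X.1.5)] -/
theorem _root_.WeierstrassCurve.Affine.exists_eq_mul_sq_of_mk_eq_mk {F : Type*} [Field F] {a a' : Fˣ}
    (h : (QuotientGroup.mk a : SqUnits F) = QuotientGroup.mk a') : ∃ s : F, s ≠ 0 ∧ (a' : F) = a * s ^ 2 :=
  exists_eq_mul_sq_of_mk_eq_sqClass a'.ne_zero (h.trans (mk_eq_sqClass_coe a'))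

/-- **The residue bit of a component is well defined**: `[a] = [a']` implies `qr_p(a) = qr_p(a')`.
[cite: SilvermanAEC2009, X.§1 (Example X.1.5), Prop. X.1.4] -/
theorem _root_.Literature.NumberTheory.EllipticCurves.TwoDescentLocal.qrBit_eq_of_mk_eq (p : ℕ) [Fact p.Prime]
    {a a' : ℚˣ} (h : (QuotientGroup.mk a : SqUnits ℚ) = QuotientGroup.mk a') : qrBit p (a : ℚ) = qrBit p (a' : ℚ) := by
  obtain ⟨s, hs, he⟩ := exists_eq_mul_sq_of_mk_eq_mk h
  rw [he, qrBit_mul p a.ne_zero (pow_ne_zero 2 hs), qrBit_sq, add_zero]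

/-- **The parity bit of a component is well defined**: `[a] = [a']` implies `v_p(a) ≡ v_p(a') (mod 2)`.
[cite: SilvermanAEC2009, X.§1 (Example X.1.5), Prop. X.1.4] -/
theorem _root_.Literature.NumberTheory.EllipticCurves.KramerTwoDescent.parityBit_eq_of_mk_eq (p : ℕ) [Fact p.Prime]
    {a a' : ℚˣ} (h : (QuotientGroup.mk a : SqUnits ℚ) = QuotientGroup.mk a') :
    parityBit p (a : ℚ) = parityBit p (a' : ℚ) := by
  obtain ⟨s, hs, he⟩ := exists_eq_mul_sq_of_mk_eq_mk h
  rw [he, parityBit_mul a.ne_zero (pow_ne_zero 2 hs)]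
  have : parityBit p (s ^ 2) = 0 := parityBit_eq_zero_iff.mpr ⟨padicValRat p s, by rw [padicValRat.pow s]; ring⟩
  rw [this, add_zero]

/-- **The sign of a component is well defined**: `[a] = [a']` implies `sign a = sign a'`.
[cite: SilvermanAEC2009, Prop. X.1.4 (the place `∞`)] -/
theorem _root_.Literature.NumberTheory.EllipticCurves.KramerTwoDescent.signBit_eq_of_mk_eq
    {a a' : ℚˣ} (h : (QuotientGroup.mk a : SqUnits ℚ) = QuotientGroup.mk a') : signBit (a : ℚ) = signBit (a' : ℚ) := by
  obtain ⟨s, hs, he⟩ := exists_eq_mul_sq_of_mk_eq_mk h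
  rw [he, signBit_mul a.ne_zero (pow_ne_zero 2 hs)]
  have : signBit (s ^ 2) = 0 := by
    rw [signBit, if_neg (not_lt.mpr (sq_nonneg s))]
  rw [this, add_zero]

variable {K : Type u} [Field K] [CharZero K] (W : WeierstrassCurve K) [W.IsElliptic] {e₁ e₂ e₃ : K}

/-- **The class `c(a, b)` only depends on the square classes of `a`, `b`.** [cite: SilvermanAEC2009, Prop. X.1.4] -/
theorem twoDescentClass_eq_of_mk_eq (h : W.toAffine.SplitTwoTorsion e₁ e₂ e₃) {a a' b b' : Kˣ}
    (ha : (QuotientGroup.mk a : SqUnits K) = QuotientGroup.mk a') (hb : (QuotientGroup.mk b : SqUnits K) = QuotientGroup.mk b') :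
    W.twoDescentClass h a b = W.twoDescentClass h a' b' :=
  W.eq_twoDescentClass_of_kummerEquiv_eq h a' b'
    (by rw [W.kummerEquiv_twoTorsionCharH1_twoDescentClass, ha])
    (by rw [W.kummerEquiv_twoTorsionCharH1_swap_twoDescentClass, hb])

/-- **Representatives of the same component have the same square class.** [cite: SilvermanAEC2009, Prop. X.1.4] -/
theorem mk_eq_mk_of_kummerEquiv_eq {x : H1Mu K 2} {a a' : Kˣ} (ha : kummerEquiv K 2 x = Additive.ofMul (QuotientGroup.mk a))
    (ha' : kummerEquiv K 2 x = Additive.ofMul (QuotientGroup.mk a')) :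
    (QuotientGroup.mk a : SqUnits K) = QuotientGroup.mk a' :=
  Additive.ofMul.injective (ha.symm.trans ha')

end Bits

/-! ## §2 The good odd places in rational currency -/

section GoodPlace

variable (W : WeierstrassCurve ℚ) [W.IsElliptic] {e₁ e₂ e₃ : ℚ}

/-- **The class of a pair of `ℓ`-unit integers, up to squares, is Selmer at a good odd place over `ℓ`**
(Silverman X.1.4: `K(S,2)²` contains the local image at `v ∉ S`): for a finite place `v` of `ℚ` over an odd
prime `ℓ` of good reduction, integers `m, m'` prime to `ℓ`, and `a, b ∈ ℚˣ` in the square classes of `m, m'`,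
`c(a, b) ∈` the local Selmer kernel at `v`. [cite: SilvermanAEC2009, Prop. X.1.4, Cor. X.4.4] -/
theorem twoDescentClass_mem_selmerLocalKer_of_mk_eq_intCast (h : W.toAffine.SplitTwoTorsion e₁ e₂ e₃)
    (v : HeightOneSpectrum (𝓞 ℚ)) (hℓ2 : (primesEquiv v : ℕ) ≠ 2) (hgood : W.HasGoodReductionAt v)
    (a b : ℚˣ) (m m' : ℤ) (hm0 : (m : ℚ) ≠ 0) (hm0' : (m' : ℚ) ≠ 0)
    (ha : (QuotientGroup.mk a : SqUnits ℚ) = QuotientGroup.mk (Units.mk0 (m : ℚ) hm0))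
    (hb : (QuotientGroup.mk b : SqUnits ℚ) = QuotientGroup.mk (Units.mk0 (m' : ℚ) hm0'))
    (hℓm : ¬ ((primesEquiv v : ℕ) : ℤ) ∣ m) (hℓm' : ¬ ((primesEquiv v : ℕ) : ℤ) ∣ m') :
    W.twoDescentClass h a b ∈ selmerLocalKer W (v.adicCompletion ℚ) 2 := by
  have h2 : (2 : 𝓞 ℚ) ∉ v.asIdeal := by
    have h := (Literature.NumberTheory.QuadraticForms.RatPlace.intCast_mem_asIdeal_iff v 2).not.mpr
      (fun hd => hℓ2 ((Nat.prime_dvd_prime_iff_eq (primesEquiv v).2 Nat.prime_two).mp (by exact_mod_cast hd)))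
    simpa using h
  have hma0 : ((m : 𝓞 ℚ) : ℚ) ≠ 0 := by rw [show ((m : 𝓞 ℚ) : ℚ) = (m : ℚ) by simp]; exact hm0
  have hmb0 : ((m' : 𝓞 ℚ) : ℚ) ≠ 0 := by rw [show ((m' : 𝓞 ℚ) : ℚ) = (m' : ℚ) by simp]; exact hm0'
  have hmv : (m : 𝓞 ℚ) ∉ v.asIdeal := by
    rw [Literature.NumberTheory.QuadraticForms.RatPlace.intCast_mem_asIdeal_iff]; exact hℓm
  have hmv' : (m' : 𝓞 ℚ) ∉ v.asIdeal := by
    rw [Literature.NumberTheory.QuadraticForms.RatPlace.intCast_mem_asIdeal_iff]; exact hℓm'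
  have key := W.twoDescentClass_mem_selmerLocalKer_of_not_mem h hgood h2 hmv hmv' hma0 hmb0
  have hua : Units.mk0 ((m : 𝓞 ℚ) : ℚ) hma0 = Units.mk0 (m : ℚ) hm0 := Units.ext (by simp)
  have hub : Units.mk0 ((m' : 𝓞 ℚ) : ℚ) hmb0 = Units.mk0 (m' : ℚ) hm0' := Units.ext (by simp)
  rw [hua, hub] at key
  rwa [W.twoDescentClass_eq_of_mk_eq h ha hb]

end GoodPlace

/-! ## §3 The count: `#E(ℚ)[2] = 4` and `#Sel⁽²⁾ = 4` -/

section Count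

variable (W : WeierstrassCurve ℚ) [W.IsElliptic] {e₁ e₂ e₃ : ℚ}

/-- **`#E(ℚ)[2] = 4` for a curve with rational `2`-torsion `e₁, e₂, e₃`** (`O, T₁, T₂, T₃`; at most four by
Silverman III Ex. 3.7). [cite: SilvermanAEC2009, III.§2 (Ex. 3.7), Prop. X.1.4] -/
theorem natCard_torsionBy_two_eq_four [inst : DecidableEq ℚ] (h : W.toAffine.SplitTwoTorsion e₁ e₂ e₃) :
    Nat.card (AddSubgroup.torsionBy W.toAffine.Point (2 : ℤ)) = 4 := by
  -- the group law behind the tree's Mordell–Weil / torsion lemmas is elaborated against the classical instance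
  have e : inst = fun a b => Classical.propDecidable (a = b) := Subsingleton.elim _ _
  subst e
  letI : DecidableEq ℚ := fun a b => Classical.propDecidable (a = b)
  haveI : Module.Finite ℤ W.toAffine.Point := W.module_finite_point_holds
  haveI : Finite (AddSubgroup.torsionBy W.toAffine.Point ((2 : ℕ) : ℤ)) :=
    finite_torsionBy_of_moduleFinite W.toAffine.Point 2
  have h4 := four_le_natCard_torsionBy_two_of_splitTwoTorsion h
  have h22 : ((2 : ℕ) : ℤ) = 2 := rfl
  rw [h22] at h4
  exact le_antisymm (W.natCard_torsionBy_two_le two_ne_zero) h4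

omit [W.IsElliptic] in
/-- **`Ш[2] = 0` as the vanishing of the `2`-torsion of `Ш ⊓ H¹(ℚ, E)[2]`.** [cite: SilvermanAEC2009, Thm. X.4.2] -/
theorem natCard_sha_inf_torsionBy_two_eq_one (hsha : ∀ x ∈ W.sha, (2 : ℕ) • x = 0 → x = 0) :
    Nat.card (W.sha ⊓ AddSubgroup.torsionBy W.galH1 (2 : ℕ) : AddSubgroup W.galH1) = 1 := by
  rw [Nat.card_eq_one_iff_unique]
  refine ⟨⟨fun x y => Subtype.ext ?_⟩, ⟨0⟩⟩
  have hx := hsha x.1 (AddSubgroup.mem_inf.mp x.2).1 (AddSubgroup.torsionBy.nsmul_iff.mp (AddSubgroup.mem_inf.mp x.2).2)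
  have hy := hsha y.1 (AddSubgroup.mem_inf.mp y.2).1 (AddSubgroup.torsionBy.nsmul_iff.mp (AddSubgroup.mem_inf.mp y.2).2)
  rw [hx, hy]

/-- **`#Sel⁽²⁾(E/ℚ) = 4` for rank `0`, `Ш[2] = 0` and full rational `2`-torsion** (exact descent count
`#Sel⁽²⁾ = 2^{rk}·#E(ℚ)[2]·#Ш[2]`, Silverman X.4.2). [cite: SilvermanAEC2009, Thm. X.4.2] -/
theorem natCard_selmerGroup_two_eq_four (h : W.toAffine.SplitTwoTorsion e₁ e₂ e₃) (hrank : W.mordellWeilRank = 0)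
    (hsha : ∀ x ∈ W.sha, (2 : ℕ) • x = 0 → x = 0) : Nat.card (W.selmerGroup 2) = 4 := by
  have := W.natCard_selmerGroup_eq (n := 2) two_ne_zero
  rw [hrank, pow_zero, one_mul, W.natCard_sha_inf_torsionBy_two_eq_one hsha, mul_one] at this
  rw [show ((2 : ℕ) : ℤ) = 2 from rfl] at this
  rw [this]
  exact W.natCard_torsionBy_two_eq_four (inst := fun a b => Classical.propDecidable (a = b)) h

end Count

/-! ## §4 The sign kernel: at most two Selmer classes with positive `T₂`-component -/

section SignKernel

variable (W : WeierstrassCurve ℚ) [W.IsElliptic] {e₁ e₂ e₃ : ℚ}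

/-- The sign of the `T₂`-component of a class, read through Kummer theory (`signHom`), is additive. [folklore] -/
private theorem signHom_comp_add (h : W.toAffine.SplitTwoTorsion e₁ e₂ e₃) (c c' : galH1Torsion W 2) :
    signHom (kummerEquiv ℚ 2 (W.twoTorsionCharH1 h.swap₁₂ (c + c'))) =
      signHom (kummerEquiv ℚ 2 (W.twoTorsionCharH1 h.swap₁₂ c)) + signHom (kummerEquiv ℚ 2 (W.twoTorsionCharH1 h.swap₁₂ c')) := by
  rw [map_add, map_add, map_add]

/-- The sign of the `T₂`-component on a representative. [cite: SilvermanAEC2009, Prop. X.1.4 (the place `∞`)] -/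
theorem signHom_kummerEquiv_eq_signBit (h : W.toAffine.SplitTwoTorsion e₁ e₂ e₃) {c : galH1Torsion W 2} {b : ℚˣ}
    (hb : kummerEquiv ℚ 2 (W.twoTorsionCharH1 h.swap₁₂ c) = Additive.ofMul (QuotientGroup.mk b)) :
    signHom (kummerEquiv ℚ 2 (W.twoTorsionCharH1 h.swap₁₂ c)) = signBit (b : ℚ) := by
  rw [hb, mk_eq_sqClass_coe, signHom_sqClass b.ne_zero]

/-- **At most two Selmer classes of a rank-zero curve with `Ш[2] = 0` have positive `T₂`-component**
(`e₁ < e₂`): `Sel⁽²⁾` has four elements and `c ↦ c + κ(T₁)` (`κ(T₁) = ((e₁-e₂)(e₁-e₃), e₁-e₂)`, second component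
NEGATIVE) is a sign-reversing injection. [cite: SilvermanAEC2009, Prop. X.1.4, Thm. X.4.2] -/
theorem natCard_selmer_signBit_eq_zero_le_two (h : W.toAffine.SplitTwoTorsion e₁ e₂ e₃) (h12 : e₁ < e₂)
    (hrank : W.mordellWeilRank = 0) (hsha : ∀ x ∈ W.sha, (2 : ℕ) • x = 0 → x = 0) :
    Nat.card {c : galH1Torsion W 2 // c ∈ W.selmerGroup 2 ∧ signHom (kummerEquiv ℚ 2 (W.twoTorsionCharH1 h.swap₁₂ c)) = 0} ≤ 2 := by
  haveI : Finite (W.selmerGroup 2) := W.finite_selmerGroup_holds two_ne_zero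
  have hcard := W.natCard_selmerGroup_two_eq_four h hrank hsha
  -- the class `κ(T₁)`
  have hδ0 : (e₁ - e₂) * (e₁ - e₃) ≠ 0 := h.c_ne_zero
  have he0 : e₁ - e₂ ≠ 0 := sub_ne_zero.mpr h.ne₁₂
  set κ := W.twoDescentClass h (Units.mk0 _ hδ0) (Units.mk0 _ he0) with hκ
  have hκS : κ ∈ W.selmerGroup 2 := twoDescentClass_mem_selmerGroup_T₁ W h _ _ rfl rfl
  have hκσ : signHom (kummerEquiv ℚ 2 (W.twoTorsionCharH1 h.swap₁₂ κ)) = 1 := by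
    rw [W.signHom_kummerEquiv_eq_signBit h (W.kummerEquiv_twoTorsionCharH1_swap_twoDescentClass h _ _), Units.val_mk0,
      signBit, if_pos (sub_neg.mpr h12)]
  -- the injection `S₊ × Fin 2 → Sel`, `(c, 0) ↦ c`, `(c, 1) ↦ c + κ`
  set S := {c : galH1Torsion W 2 // c ∈ W.selmerGroup 2 ∧ signHom (kummerEquiv ℚ 2 (W.twoTorsionCharH1 h.swap₁₂ c)) = 0}
  let f : S × Fin 2 → W.selmerGroup 2 := fun x =>
    if x.2 = 0 then ⟨x.1.1, x.1.2.1⟩ else ⟨x.1.1 + κ, add_mem x.1.2.1 hκS⟩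
  have hf : Function.Injective f := by
    rintro ⟨⟨c, hcS, hcσ⟩, i⟩ ⟨⟨c', hcS', hcσ'⟩, j⟩ hij
    have key : ∀ {x y : galH1Torsion W 2}, signHom (kummerEquiv ℚ 2 (W.twoTorsionCharH1 h.swap₁₂ x)) = 0 →
        signHom (kummerEquiv ℚ 2 (W.twoTorsionCharH1 h.swap₁₂ y)) = 0 → x ≠ y + κ := by
      intro x y hx hy hxy
      rw [hxy, W.signHom_comp_add h.swap₁₂.swap₁₂] at hx
      change signHom (kummerEquiv ℚ 2 (W.twoTorsionCharH1 h.swap₁₂ y)) +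
        signHom (kummerEquiv ℚ 2 (W.twoTorsionCharH1 h.swap₁₂ κ)) = 0 at hx
      rw [hy, hκσ, zero_add] at hx
      exact one_ne_zero hx
    fin_cases i <;> fin_cases j
    · simp only [f, Fin.zero_eta, Fin.isValue, ↓reduceIte, Subtype.mk.injEq] at hij
      subst hij; rfl
    · simp only [f, Fin.zero_eta, Fin.isValue, ↓reduceIte, Fin.mk_one, one_ne_zero, Subtype.mk.injEq] at hij
      exact absurd hij (key hcσ hcσ')
    · simp only [f, Fin.zero_eta, Fin.isValue, ↓reduceIte, Fin.mk_one, one_ne_zero, Subtype.mk.injEq] at hij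
      exact absurd hij.symm (key hcσ' hcσ)
    · simp only [f, Fin.mk_one, Fin.isValue, one_ne_zero, ↓reduceIte, Subtype.mk.injEq, add_left_inj] at hij
      subst hij; rfl
  have := Nat.card_le_card_of_injective f hf
  rw [Nat.card_prod, hcard, Nat.card_eq_fintype_card (α := Fin 2), Fintype.card_fin] at this
  omega

end SignKernel

/-! ## §5 The residue kernel at a prime where `δ₁`, `δ₂` are non-residues -/

section ResidueKernel

variable (W : WeierstrassCurve ℚ) [W.IsElliptic] {e₁ e₂ e₃ : ℚ}

/-- The residue bit at `q` of the `Tᵢ`-component of a class, read through Kummer theory (`qrHom`), on a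
representative. [cite: SilvermanAEC2009, X.§1 (Example X.1.5), Prop. X.1.4] -/
theorem qrHom_kummerEquiv_eq_qrBit {a₁ a₂ a₃ : ℚ} (h : W.toAffine.SplitTwoTorsion a₁ a₂ a₃) (q : ℕ) [Fact q.Prime]
    {c : galH1Torsion W 2} {a : ℚˣ} (ha : kummerEquiv ℚ 2 (W.twoTorsionCharH1 h c) = Additive.ofMul (QuotientGroup.mk a)) :
    qrHom q (kummerEquiv ℚ 2 (W.twoTorsionCharH1 h c)) = qrBit q (a : ℚ) := by
  rw [ha, mk_eq_sqClass_coe, qrHom_sqClass q a.ne_zero]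

/-- A bit of `ℤ/2` is `0` or `1`. [folklore] -/
private theorem zmod2_cases (x : ZMod 2) : x = 0 ∨ x = 1 := by revert x; decide

/-- **The residue kernel is trivial.** Let `E/ℚ` have rational `2`-torsion, rank `0` and `Ш[2] = 0`, and let
`q` be a prime with `qr_q(-1) = 1` (`q ≡ 3 (mod 4)`) at which `δ₁ = (e₁-e₂)(e₁-e₃)` and `δ₂ = (e₂-e₁)(e₂-e₃)`
are NON-residues (`qr_q = 1`; e.g. `q` inert in the three quadratic fields `ℚ(E'[2])`). Then the only class
`c ∈ Sel⁽²⁾(E/ℚ)` both of whose components are residues at `q` is `c = 0`.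
[cite: SilvermanAEC2009, Prop. X.1.4, Thm. X.4.2] -/
theorem eq_zero_of_mem_selmerGroup_of_qrBit_eq_zero (h : W.toAffine.SplitTwoTorsion e₁ e₂ e₃)
    (hrank : W.mordellWeilRank = 0) (hsha : ∀ x ∈ W.sha, (2 : ℕ) • x = 0 → x = 0) {q : ℕ} [Fact q.Prime]
    (hm1 : qrBit q (-1 : ℚ) = 1) (hδ₁ : qrBit q ((e₁ - e₂) * (e₁ - e₃)) = 1) (hδ₂ : qrBit q ((e₂ - e₁) * (e₂ - e₃)) = 1)
    {c : galH1Torsion W 2} (hc : c ∈ W.selmerGroup 2) (a b : ℚˣ)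
    (ha : kummerEquiv ℚ 2 (W.twoTorsionCharH1 h c) = Additive.ofMul (QuotientGroup.mk a))
    (hb : kummerEquiv ℚ 2 (W.twoTorsionCharH1 h.swap₁₂ c) = Additive.ofMul (QuotientGroup.mk b))
    (hqa : qrBit q (a : ℚ) = 0) (hqb : qrBit q (b : ℚ) = 0) : c = 0 := by
  haveI : Finite (W.selmerGroup 2) := W.finite_selmerGroup_holds two_ne_zero
  have hcard := W.natCard_selmerGroup_two_eq_four h hrank hsha
  have he12 : e₁ - e₂ ≠ 0 := sub_ne_zero.mpr h.ne₁₂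
  have he21 : e₂ - e₁ ≠ 0 := sub_ne_zero.mpr h.ne₁₂.symm
  have he13 : e₁ - e₃ ≠ 0 := sub_ne_zero.mpr h.ne₁₃
  have he23 : e₂ - e₃ ≠ 0 := sub_ne_zero.mpr h.ne₂₃
  -- the bit-pair map `λ = (qr_q ∘ comp₁, qr_q ∘ comp₂)` (additive)
  let lam : galH1Torsion W 2 → ZMod 2 × ZMod 2 := fun x =>
    (qrHom q (kummerEquiv ℚ 2 (W.twoTorsionCharH1 h x)), qrHom q (kummerEquiv ℚ 2 (W.twoTorsionCharH1 h.swap₁₂ x)))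
  have lam_add : ∀ x y, lam (x + y) = lam x + lam y := fun x y => by
    simp only [lam, map_add, Prod.mk_add_mk]
  -- the classes `κ₁ = κ(T₁)`, `κ₂ = κ(T₂)` and their bits
  set κ₁ := W.twoDescentClass h (Units.mk0 _ h.c_ne_zero) (Units.mk0 _ he12) with hκ₁
  set κ₂ := W.twoDescentClass h (Units.mk0 _ he21) (Units.mk0 _ h.swap₁₂.c_ne_zero) with hκ₂
  have hκ₁S : κ₁ ∈ W.selmerGroup 2 := twoDescentClass_mem_selmerGroup_T₁ W h _ _ rfl rfl
  have hκ₂S : κ₂ ∈ W.selmerGroup 2 := twoDescentClass_mem_selmerGroup_T₂ W h _ _ rfl rfl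
  set t := qrBit q (e₂ - e₁) with ht
  have ht' : qrBit q (e₁ - e₂) = t + 1 := by
    rw [show e₁ - e₂ = (-1) * (e₂ - e₁) by ring, qrBit_mul q (by norm_num) he21, hm1, ht, add_comm]
  have hl₁ : lam κ₁ = (1, t + 1) := by
    simp only [lam]
    rw [W.qrHom_kummerEquiv_eq_qrBit h q (W.kummerEquiv_twoTorsionCharH1_twoDescentClass h _ _),
      W.qrHom_kummerEquiv_eq_qrBit h.swap₁₂ q (W.kummerEquiv_twoTorsionCharH1_swap_twoDescentClass h _ _),
      Units.val_mk0, Units.val_mk0, hδ₁, ht']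
  have hl₂ : lam κ₂ = (t, 1) := by
    simp only [lam]
    rw [W.qrHom_kummerEquiv_eq_qrBit h q (W.kummerEquiv_twoTorsionCharH1_twoDescentClass h _ _),
      W.qrHom_kummerEquiv_eq_qrBit h.swap₁₂ q (W.kummerEquiv_twoTorsionCharH1_swap_twoDescentClass h _ _),
      Units.val_mk0, Units.val_mk0, hδ₂]
  have hl₀ : lam 0 = (0, 0) := by simp only [lam, _root_.map_zero]
  have hl₃ : lam (κ₁ + κ₂) = (1 + t, t + 1 + 1) := by rw [lam_add, hl₁, hl₂]; rfl
  have hlc : lam c = (0, 0) := by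
    simp only [lam]
    rw [W.qrHom_kummerEquiv_eq_qrBit h q ha, W.qrHom_kummerEquiv_eq_qrBit h.swap₁₂ q hb, hqa, hqb]
  -- the four elements `0, κ₁, κ₂, κ₁ + κ₂` of `Sel⁽²⁾` are distinct (distinct bits), hence all of it
  let g : Fin 4 → W.selmerGroup 2 := ![⟨0, zero_mem _⟩, ⟨κ₁, hκ₁S⟩, ⟨κ₂, hκ₂S⟩, ⟨κ₁ + κ₂, add_mem hκ₁S hκ₂S⟩]
  have hg_lam : ∀ i, lam (g i : galH1Torsion W 2) = ![((0 : ZMod 2), (0 : ZMod 2)), (1, t + 1), (t, 1), (1 + t, t + 1 + 1)] i := by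
    intro i; fin_cases i
    · exact hl₀
    · exact hl₁
    · exact hl₂
    · exact hl₃
  have hg : Function.Injective g := by
    intro i j hij
    have := congrArg (fun x : W.selmerGroup 2 => lam (x : galH1Torsion W 2)) hij
    simp only [hg_lam] at this
    rcases zmod2_cases t with ht0 | ht1
    · rw [ht0] at this
      fin_cases i <;> fin_cases j <;> first | rfl | (exfalso; revert this; decide)
    · rw [ht1] at this
      fin_cases i <;> fin_cases j <;> first | rfl | (exfalso; revert this; decide)
  have hbij : Function.Bijective g := hg.bijective_of_nat_card_le (by
    rw [hcard, Nat.card_eq_fintype_card, Fintype.card_fin])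
  obtain ⟨i, hi⟩ := hbij.2 ⟨c, hc⟩
  have hci : lam c = ![((0 : ZMod 2), (0 : ZMod 2)), (1, t + 1), (t, 1), (1 + t, t + 1 + 1)] i := by
    rw [← hg_lam i, hi]
  rw [hlc] at hci
  have hi0 : i = 0 := by
    rcases zmod2_cases t with ht0 | ht1
    · rw [ht0] at hci; fin_cases i <;> first | rfl | (exfalso; revert hci; decide)
    · rw [ht1] at hci; fin_cases i <;> first | rfl | (exfalso; revert hci; decide)
  rw [hi0] at hi
  exact (congrArg Subtype.val hi).symm

end ResidueKernel

end WeierstrassCurve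

end
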